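import Summits.MatrixMultiplication.MatrixMultiplication.Theses.DesignFlattening

/-!
# MatrixMultiplication / DesignFlattening — `GrowingHostDesigns`, stub `stub_canonicalHost`

Route `DesignFlattening`, crux `GrowingHostDesigns` (stmt-MatrixMultiplication-8033), line `birth`:
the TIGHT SQUARE HOST.  For every `m ≥ 1` the matrix multiplication tensor `⟨m,m,m⟩` is hosted ON THE
NOSE in the punctured addition table of `G_m := ℤ_m × ℤ_m` with kept set
`P_m := {(b, c) ∈ G_m × G_m | b₂ + c₁ = 0}`, i.e. there are index maps `α β γ : [m]² → G_m` with
`⟨m,m,m⟩(x; y, z) = [β y + γ z = α x ∧ (β y)₂ + (γ z)₁ = 0]`.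

Witnesses (writing `c : Fin m → ZMod m` for the cast): `α (κ, ν) = (c κ, c ν)`,
`β (κ', μ) = (c κ' + c μ, c μ)`, `γ (μ', ν') = (− c μ', c ν' − c μ')`.  Then
`(β y)₂ + (γ z)₁ = c μ − c μ'` and `β y + γ z = (c κ' + c μ − c μ', c μ + c ν' − c μ')`, so the
host condition reads `c μ = c μ' ∧ c κ' = c κ ∧ c ν' = c ν`, which is `κ = κ' ∧ μ = μ' ∧ ν = ν'`
because the cast `Fin m → ZMod m` is injective (`ZMod.val_natCast_of_lt`).  This is the Cohn–Umans
triple factorisation `ℤ_m² = A ⊕ C = A ⊕ U = C ⊕ (−U)` with `A = ℤ_m × 0`, `C = 0 × ℤ_m`,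
`U = {(μ, μ)}`.

Sources: Cohn–Umans 2003 (group-theoretic hosting of `⟨m,m,m⟩`); Bläser 2013 §5 (the tensor
`⟨k,m,n⟩`).
-/

-- the tree's namespace `Summit.MatrixMultiplication.MatrixMultiplication.…` repeats a component by design
set_option linter.dupNamespace false

namespace Summit.MatrixMultiplication.MatrixMultiplication.Theorems

open Summit.MatrixMultiplication.MatrixMultiplication.Theses.DesignFlattening
open Literature.Computability.AlgebraicComplexity

/-- The cast `Fin m → ZMod m`, `i ↦ ((i : ℕ) : ZMod m)`, is injective: two indices below `m` with the
same residue mod `m` are equal (`ZMod.val_natCast_of_lt`). -/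
private theorem fin_natCast_zmod_eq_iff {m : ℕ} (i j : Fin m) :
    ((i : ℕ) : ZMod m) = ((j : ℕ) : ZMod m) ↔ i = j := by
  constructor
  · intro h
    have hv := congrArg ZMod.val h
    rw [ZMod.val_natCast_of_lt i.is_lt, ZMod.val_natCast_of_lt j.is_lt] at hv
    exact Fin.ext hv
  · rintro rfl
    rfl

/-- **Stub `stub_canonicalHost`** (crux `GrowingHostDesigns`, stmt-MatrixMultiplication-8033, line
`birth`): the tight square host.  For every `m ≥ 1` the index maps `α (κ, ν) = (κ, ν)`,
`β (κ', μ) = (κ' + μ, μ)`, `γ (μ', ν') = (−μ', ν' − μ')` (entries cast into `ZMod m`) host `⟨m,m,m⟩`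
ON THE NOSE in the punctured table `[b + c = a ∧ b₂ + c₁ = 0]` of `G_m = ℤ_m × ℤ_m`:
`(β y)₂ + (γ z)₁ = μ − μ'` and, given `μ = μ'`, `β y + γ z = (κ', ν')`, so the host condition is
`κ = κ' ∧ μ = μ' ∧ ν = ν'` by injectivity of `Fin m → ZMod m`.  Stated existentially over the maps,
exactly in the hypothesis shape of `SingleBlockSeparableFloor`. -/
theorem stub_canonicalHost :
    ∀ (m : ℕ) [NeZero m], ∃ α β γ : Fin m × Fin m → ZMod m × ZMod m, ∀ x y z : Fin m × Fin m,
      matMulTensor ℂ m m m x y z =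
        (if β y + γ z = α x ∧ (β y, γ z) ∈
            (Finset.univ.filter fun bc : (ZMod m × ZMod m) × (ZMod m × ZMod m) =>
              bc.1.2 + bc.2.1 = 0)
          then (1 : ℂ) else 0) := by
  intro m _
  refine ⟨fun x => (((x.1 : ℕ) : ZMod m), ((x.2 : ℕ) : ZMod m)),
    fun y => (((y.1 : ℕ) : ZMod m) + ((y.2 : ℕ) : ZMod m), ((y.2 : ℕ) : ZMod m)),
    fun z => (-(((z.1 : ℕ) : ZMod m)), ((z.2 : ℕ) : ZMod m) - ((z.1 : ℕ) : ZMod m)), ?_⟩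
  rintro ⟨κ, ν⟩ ⟨κ', μ⟩ ⟨μ', ν'⟩
  simp only [matMulTensor, Finset.mem_filter, Finset.mem_univ, true_and, Prod.mk_add_mk,
    Prod.mk.injEq]
  refine if_congr ?_ rfl rfl
  constructor
  · rintro ⟨rfl, rfl, rfl⟩
    exact ⟨⟨by ring, by ring⟩, by ring⟩
  · rintro ⟨⟨h1, h2⟩, h3⟩
    have hμ : μ = μ' := (fin_natCast_zmod_eq_iff μ μ').1 (by linear_combination h3)
    subst hμ
    refine ⟨(fin_natCast_zmod_eq_iff κ κ').1 (by linear_combination -h1), rfl,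
      (fin_natCast_zmod_eq_iff ν ν').1 (by linear_combination -h2)⟩

end Summit.MatrixMultiplication.MatrixMultiplication.Theorems
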